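import Literature.AlgebraicTopology.Homotopy.WhiteheadCWExtension
import Literature.Topology.Euclidean.LatticeCubeComplex
import Literature.Topology.FourManifolds.NormalRetraction
import Mathlib.Geometry.Manifold.WhitneyEmbedding
import Mathlib.Analysis.InnerProductSpace.PiL2
import HarnessLib

/-!
# Weakly contractible compact retracts in Euclidean space and in closed manifolds are contractible

Topic `Literature/Topology/FourManifolds`. Whitehead's theorem in the form needed for subsets of
smooth manifolds which carry no CW structure of their own: a compact space `Y` which is a
retract of an open subset of `ℝᴺ` — in particular (Whitney embedding + tubular neighbourhood
retraction) a compact retract `K` of an open subset `U` of a closed smooth manifold — is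
dominated by a finite CW complex (a small cubical neighbourhood, `LatticeCubeComplex.lean`), so
if `Y` is path connected with all homotopy groups `π_k(Y, y₀) = 0` then `Y` is contractible
(`WhiteheadCWExtension.lean`: a weakly contractible space dominated by a CW complex is
contractible; Hatcher, *Algebraic Topology* (2002), Thm. 4.5 with Prop. A.11, and Cor. A.12:
"a compact manifold is homotopy equivalent to a CW complex" proved there through exactly this
Euclidean neighbourhood retract argument).

* `Literature.Topology.FourManifolds.contractibleSpace_of_retract_pi`,
  `Literature.Topology.FourManifolds.contractibleSpace_of_retract_euclideanSpace`: a compact,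
  path connected `Y` with `π_k(Y, y₀) = 0` (`k ≥ 1`), admitting `s : Y → ℝᴺ` continuous with
  image in an open `O` and `d : O → Y` continuous with `d ∘ s = id`, is contractible.
* `Literature.Topology.FourManifolds.contractibleSpace_of_retract_of_compactSpace_manifold`: for a
  closed smooth manifold `M` (compact, Hausdorff, boundaryless model with corners on a
  finite-dimensional inner product space), an open `U ⊆ M` and a compact `K ⊆ U` which is a
  retract of `U`, if `↥K` is path connected with `π_k(K, y₀) = 0` for all `k ≥ 1` then `↥K` is
  contractible. Proof: Whitney (`exists_embedding_euclidean_of_compact`, Mathlib) embeds `M` in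
  some `ℝᴺ`; the tree's smooth normal retraction `r` of a tube `W ⊇ e(M)` onto `M`
  (`Literature.Topology.FourManifolds.exists_normalRetraction`, Hirsch 1976, Ch. 4 §5) makes `K` a
  retract of the open set `W ∩ r⁻¹(U) ⊆ ℝᴺ`, and the first statement applies.

Consumer: the contractibility of punctured homotopy spheres from the Hurewicz theorem alone
(`PuncturedHomotopySphereContractible.lean`; Kervaire–Milnor 1963, proof of Lemma 2.4), where
`K = Σ ∖ i(B)` is a retract of `U = Σ ∖ {p}`. Everything here is proved; no named facts.

## References

* A. Hatcher, *Algebraic Topology*, CUP (2002), §4.1 Thm. 4.5; Appendix, Prop. A.11,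
  Cor. A.12. [HatcherAT2002]
* M. W. Hirsch, *Differential Topology*, GTM 33 (1976), Ch. 4 §5 (tubular neighbourhoods,
  the retraction `r : W → V`). [HirschDT1976]
-/

noncomputable section

open Set Function Metric Topology
open scoped Manifold ContDiff Topology ContinuousMap

namespace Literature.Topology.FourManifolds

universe u v

/-! ### Compact retracts of open subsets of `ℝᴺ` -/

/-- **A weakly contractible compact retract of an open subset of `ℝᴺ = Fin N → ℝ` is
contractible.** If `Y` is compact and path connected with `π_k(Y, y₀) = 0` for all `k ≥ 1`, and
there are a continuous `s : Y → ℝᴺ` with image in an open set `O` and a map `d`, continuous on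
`O`, with `d (s y) = y`, then `Y` is contractible: `s(Y)` lies in a finite cube complex
`K ⊆ O` (`Literature.Topology.Euclidean.exists_cwComplex_nbhd_of_isCompact`), so `Y` is
dominated by the finite CW complex `↥K` and Whitehead's theorem for CW-dominated spaces
(`Literature.AlgebraicTopology.Homotopy.contractibleSpace_of_cwDominated_of_subsingleton_homotopyGroup`,
Hatcher 2002, Thm. 4.5 + Prop. A.11) applies. [cite: HatcherAT2002, §4.1 Thm. 4.5 and Appendix Prop. A.11] -/
theorem contractibleSpace_of_retract_pi {N : ℕ} {Y : Type v} [TopologicalSpace Y]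
    [CompactSpace Y] [PathConnectedSpace Y] (y₀ : Y)
    (hπ : ∀ k : ℕ, 1 ≤ k → Subsingleton (π_ k Y y₀)) {O : Set (Fin N → ℝ)} (hO : IsOpen O)
    (s : C(Y, Fin N → ℝ)) (hsO : range s ⊆ O) (d : (Fin N → ℝ) → Y) (hd : ContinuousOn d O)
    (hds : ∀ y, d (s y) = y) : ContractibleSpace Y := by
  obtain ⟨K, instK, -, -, hSK, hKO⟩ := Literature.Topology.Euclidean.exists_cwComplex_nbhd_of_isCompact
    (isCompact_range s.continuous) hO hsO
  letI := instK
  let i : C(Y, ↥K) := ⟨fun y => ⟨s y, hSK ⟨y, rfl⟩⟩, s.continuous.subtype_mk _⟩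
  let d' : C(↥K, Y) := ⟨fun z => d z, hd.comp_continuous continuous_subtype_val fun z => hKO z.2⟩
  refine Literature.AlgebraicTopology.Homotopy.contractibleSpace_of_cwDominated_of_subsingleton_homotopyGroup
    y₀ hπ i d' ?_
  have h : d'.comp i = ContinuousMap.id Y := by
    ext y
    exact hds y
  rw [h]

/-- The same with ambient space `EuclideanSpace ℝ (Fin N)` (the target of Mathlib's Whitney
embedding), transported along the continuous linear identification
`EuclideanSpace ℝ (Fin N) ≃L[ℝ] (Fin N → ℝ)`. [cite: HatcherAT2002, §4.1 Thm. 4.5 and Appendix Prop. A.11] -/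
theorem contractibleSpace_of_retract_euclideanSpace {N : ℕ} {Y : Type v} [TopologicalSpace Y]
    [CompactSpace Y] [PathConnectedSpace Y] (y₀ : Y)
    (hπ : ∀ k : ℕ, 1 ≤ k → Subsingleton (π_ k Y y₀)) {O : Set (EuclideanSpace ℝ (Fin N))}
    (hO : IsOpen O) (s : C(Y, EuclideanSpace ℝ (Fin N))) (hsO : range s ⊆ O)
    (d : EuclideanSpace ℝ (Fin N) → Y) (hd : ContinuousOn d O) (hds : ∀ y, d (s y) = y) :
    ContractibleSpace Y := by
  let L := EuclideanSpace.equiv (Fin N) ℝ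
  have hO' : IsOpen (L.symm ⁻¹' O) := L.symm.continuous.isOpen_preimage O hO
  refine contractibleSpace_of_retract_pi y₀ hπ hO' (⟨L ∘ s, L.continuous.comp s.continuous⟩)
    ?_ (d ∘ L.symm) (hd.comp L.symm.continuous.continuousOn fun z hz => hz) fun y => ?_
  · rintro _ ⟨y, rfl⟩
    show L.symm (L (s y)) ∈ O
    rw [L.symm_apply_apply]
    exact hsO ⟨y, rfl⟩
  · show d (L.symm (L (s y))) = y
    rw [L.symm_apply_apply]
    exact hds y

/-! ### Compact retracts of open subsets of closed manifolds -/

/-- **A weakly contractible compact retract of an open subset of a closed smooth manifold is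
contractible.** Let `M` be a compact Hausdorff `C^∞` manifold without boundary, modelled (with
corners `I`, boundaryless) on a finite-dimensional real inner product space, `U ⊆ M` open and
`K ⊆ U` compact with a retraction `ρ : U → K` (`ρ x = x` on `K`). If `↥K` is path connected and
`π_k(K, y₀) = 0` for all `k ≥ 1`, then `↥K` is contractible. Proof: embed `M ⊆ ℝᴺ` (Whitney,
Mathlib's `exists_embedding_euclidean_of_compact`), retract a tube `W ⊇ M` smoothly onto `M`
(`exists_normalRetraction`, Hirsch 1976, Ch. 4 §5, `r ∘ e = id`); then `K` is a retract of the
open set `W ∩ r⁻¹(U)` of `ℝᴺ` by `ρ ∘ r`, and `contractibleSpace_of_retract_euclideanSpace`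
applies (Hatcher 2002, Thm. 4.5 + Prop. A.11; this is the argument of Cor. A.12).
[cite: HatcherAT2002, Appendix Prop. A.11 and Cor. A.12] [cite: HirschDT1976, Ch. 4 §5] -/
theorem contractibleSpace_of_retract_of_compactSpace_manifold
    {E : Type*} [NormedAddCommGroup E] [InnerProductSpace ℝ E] [FiniteDimensional ℝ E]
    {H : Type*} [TopologicalSpace H] {I : ModelWithCorners ℝ E H} [I.Boundaryless]
    {M : Type u} [TopologicalSpace M] [ChartedSpace H M] [IsManifold I ∞ M] [T2Space M]
    [CompactSpace M] {U K : Set M} (hU : IsOpen U) (hK : IsCompact K) (hKU : K ⊆ U)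
    (ρ : C(↥U, ↥K)) (hρ : ∀ (x : M) (hx : x ∈ K), ρ ⟨x, hKU hx⟩ = ⟨x, hx⟩)
    [PathConnectedSpace ↥K] (y₀ : ↥K) (hπ : ∀ k : ℕ, 1 ≤ k → Subsingleton (π_ k ↥K y₀)) :
    ContractibleSpace ↥K := by
  classical
  haveI : Nonempty M := ⟨(y₀ : M)⟩
  haveI : CompactSpace ↥K := isCompact_iff_compactSpace.mp hK
  -- Whitney embedding and the normal retraction of a tube
  obtain ⟨N, e, he, hemb, hinj⟩ := exists_embedding_euclidean_of_compact (I := I) (M := M)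
  obtain ⟨ε, hε, hWopen, hrs, hr⟩ := exists_normalRetraction (I := I) he hemb.injective hinj
  set W := normalTube I e ε with hW
  set r := normalRetraction I e ε with hrdef
  have hre : ∀ x : M, e x ∈ W ∧ r (e x) = x := fun x => by
    have h := hr x 0 (Submodule.zero_mem _) (by simpa using hε)
    rwa [add_zero] at h
  -- the open set `O = W ∩ r⁻¹(U)` of the Euclidean space, retracting onto `K` by `ρ ∘ r`
  have hrc : ContinuousOn r W := hrs.continuousOn
  have hO : IsOpen (W ∩ r ⁻¹' U) := hrc.isOpen_inter_preimage hWopen hU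
  let ρ' : M → ↥K := fun x => if hx : x ∈ U then ρ ⟨x, hx⟩ else y₀
  have hρ'U : ∀ (x : M) (hx : x ∈ U), ρ' x = ρ ⟨x, hx⟩ := fun x hx => dif_pos hx
  have hρ'c : ContinuousOn ρ' U := by
    rw [continuousOn_iff_continuous_restrict]
    have heq : U.restrict ρ' = ρ := by
      funext x
      exact hρ'U x x.2
    rw [heq]
    exact ρ.continuous
  have hd : ContinuousOn (ρ' ∘ r) (W ∩ r ⁻¹' U) :=
    hρ'c.comp (hrc.mono inter_subset_left) fun z hz => hz.2
  let s : C(↥K, EuclideanSpace ℝ (Fin N)) :=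
    ⟨fun y => e y, he.continuous.comp continuous_subtype_val⟩
  refine contractibleSpace_of_retract_euclideanSpace y₀ hπ hO s ?_ (ρ' ∘ r) hd fun y => ?_
  · rintro _ ⟨y, rfl⟩
    refine ⟨(hre y).1, ?_⟩
    show r (e y) ∈ U
    rw [(hre y).2]
    exact hKU y.2
  · show ρ' (r (e y)) = y
    rw [(hre y).2, hρ'U _ (hKU y.2), hρ _ y.2]

end Literature.Topology.FourManifolds

end
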